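import Summits.Parity.BatemanHorn.Theorems.AlmostPrimeZerosSystemMomentDeficitMassCountBlock
import Summits.Parity.BatemanHorn.Theorems.AlmostPrimeZerosSystemMomentDeficitLocalisationCore
import Summits.Parity.BatemanHorn.Theorems.AlmostPrimeZerosSystemMomentDeficitLinearK1Rough

/-!
# Crux `SystemMomentDeficit` (stmt-Parity-11326): the mass/count split — core estimate and size lemmas

Route `AlmostPrimeZeros`, crux `Summit.Parity.BatemanHorn.Theses.AlmostPrimeZeros.SystemMomentDeficit`
(rank 4).  Second file of the MASS companion of the crux's canonical form
(`Localisation.systemMomentDeficit_iff_covLowerBound`; main theorem `abs_cov_smallCount_roughMass_le` in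
`AlmostPrimeZerosSystemMomentDeficitMassCount.lean`):

* `abs_cov_smallCount_smallMass_le_core` — for every Bateman–Horn system and `x ≥ 4`,
  `|Cov_x(A, R)| ≤ C_f` for the small count `A(n) = Σᵢ #{q ∈ PP(⌊√x⌋) : q ∣ fᵢ(n)⁺ ≠ 0}` and the small
  von Mangoldt mass `R(n) = (Σᵢ Σ_{q ∈ PP(⌊√x⌋), q ∣ fᵢ(n)⁺ ≠ 0} Λ(q)) / log x` (the block
  `MassCount.rblock_abs_le` instantiated with the landed CRT / resultant / root-count inputs exactly as in
  `Localisation.localisation_core`, then `log ⌊√x⌋ ≤ log x`);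
* size lemmas for the third file: `sum_log_sub_log_le` (`Σ_{n ≤ x} log(x/n) ≤ 2x`),
  `exists_forall_pow_le_two_mul_eval` (`n^d ≤ 2 g(n)` eventually), `smallCount_le_log`
  (`A = O(log x)` pointwise), `abs_cov_le_two_mul_sup_mul_mean_abs` (`|Cov(a, g)| ≤ 2 sup a · E|g − c|`).

Notation (docstrings only).  `Y = x + 1`, `E g = Y⁻¹ Σ_{0 ≤ n ≤ x} g(n)`, `Cov(g, h) = E(gh) − E g · E h`,
`PP(z)` = primes `≤ z` ∪ prime squares `≤ z`, `Λ` = von Mangoldt.  Everything is [folklore].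
-/

namespace Summit.Parity.BatemanHorn.Cruxes.SystemMomentDeficit.MassCount

open scoped BigOperators
open Finset Polynomial
open Literature.NumberTheory.Sieve
open Summit.Parity.BatemanHorn.Theorems.AlmostPrimeZeros.SystemMertens
open Summit.Parity.BatemanHorn.Cruxes.SystemMomentDeficit.Ideator3Sketch
open Summit.Parity.BatemanHorn.Cruxes.SystemMomentDeficit.Localisation

/-! ### Core estimate: the small count against the small von Mangoldt mass -/

/-- Rescaling the second variable of an empirical covariance by a constant. [folklore] -/
theorem cov_div_const (x : ℕ) (a r : ℕ → ℝ) (Y L : ℝ) :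
    (∑ n ∈ range (x + 1), a n * (r n / L)) / Y - (∑ n ∈ range (x + 1), a n) / Y * ((∑ n ∈ range (x + 1), r n / L) / Y) =
      ((∑ n ∈ range (x + 1), a n * r n) / Y - (∑ n ∈ range (x + 1), a n) / Y * ((∑ n ∈ range (x + 1), r n) / Y)) / L := by
  have h1 : ∑ n ∈ range (x + 1), a n * (r n / L) = (∑ n ∈ range (x + 1), a n * r n) / L := by
    rw [sum_div]
    exact sum_congr rfl fun n _ => by ring
  rw [h1, ← sum_div]
  ring

set_option maxHeartbeats 800000 in -- one long bookkeeping proof (≈ 2× the default budget)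
/-- **Core estimate of the mass/count split.**  For a Bateman–Horn system `f` there is `C` such that
for every `x ≥ 4`, with `A(n) = Σᵢ #{q ∈ PP(⌊√x⌋) : q ∣ fᵢ(n)⁺ ≠ 0}` (the small COUNT of the
localisation) and `R(n) = (Σᵢ Σ_{q ∈ PP(⌊√x⌋), q ∣ fᵢ(n)⁺ ≠ 0} Λ(q)) / log x` (the small von Mangoldt
MASS, normalised by `log x`): `|Cov_x(A, R)| ≤ C` (block `rblock_abs_le` with the landed CRT / resultant /
root-count inputs of `Localisation.localisation_core`, and `log ⌊√x⌋ ≤ log x`). [folklore] -/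
theorem abs_cov_smallCount_smallMass_le_core :
    ∀ (k : ℕ) (f : Fin k → ℤ[X]), IsBatemanHornSystem f →
    ∃ C : ℝ, ∀ x : ℕ, 4 ≤ x →
      |(∑ n ∈ Finset.range (x + 1),
          ((∑ i, #((Nat.primesLE (Nat.sqrt x) ∪ ((Nat.primesLE (Nat.sqrt x)).filter (fun p => p ^ 2 ≤ Nat.sqrt x)).image (fun p => p ^ 2)).filter (fun q => q ∣ ((f i).eval (n : ℤ)).toNat ∧ ((f i).eval (n : ℤ)).toNat ≠ 0)) : ℕ) : ℝ) *
            ((∑ i, ∑ q ∈ (Nat.primesLE (Nat.sqrt x) ∪ ((Nat.primesLE (Nat.sqrt x)).filter (fun p => p ^ 2 ≤ Nat.sqrt x)).image (fun p => p ^ 2)).filter (fun q => q ∣ ((f i).eval (n : ℤ)).toNat ∧ ((f i).eval (n : ℤ)).toNat ≠ 0), ArithmeticFunction.vonMangoldt q) / Real.log x)) / ((x : ℝ) + 1) -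
        (∑ n ∈ Finset.range (x + 1),
          ((∑ i, #((Nat.primesLE (Nat.sqrt x) ∪ ((Nat.primesLE (Nat.sqrt x)).filter (fun p => p ^ 2 ≤ Nat.sqrt x)).image (fun p => p ^ 2)).filter (fun q => q ∣ ((f i).eval (n : ℤ)).toNat ∧ ((f i).eval (n : ℤ)).toNat ≠ 0)) : ℕ) : ℝ)) / ((x : ℝ) + 1) *
          ((∑ n ∈ Finset.range (x + 1),
            (∑ i, ∑ q ∈ (Nat.primesLE (Nat.sqrt x) ∪ ((Nat.primesLE (Nat.sqrt x)).filter (fun p => p ^ 2 ≤ Nat.sqrt x)).image (fun p => p ^ 2)).filter (fun q => q ∣ ((f i).eval (n : ℤ)).toNat ∧ ((f i).eval (n : ℤ)).toNat ≠ 0), ArithmeticFunction.vonMangoldt q) / Real.log x) / ((x : ℝ) + 1))| ≤ C := by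
  intro k f hf
  classical
  /- ### constants (independent of `x`) -/
  choose Cp hCp using fun i j => stub_nearPairCov stub_crtPairCount (f i) (f j) (hf.irreducible i)
    (hf.natDegree_pos i) (hf.leadingCoeff_pos i) (hf.irreducible j) (hf.natDegree_pos j)
    (hf.leadingCoeff_pos j)
  choose Cu hCu using fun i j => nearPairCov_upper (f i) (f j) (hf.irreducible i)
    (hf.natDegree_pos i) (hf.leadingCoeff_pos i) (hf.irreducible j) (hf.natDegree_pos j)
    (hf.leadingCoeff_pos j)
  choose M hM1 hM hρ using fun i => exists_rootCount_primePow_le (hf.irreducible i) (hf.natDegree_pos i)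
  obtain ⟨P₀, hP₀⟩ := exists_forall_not_dvd_eval_and_dvd_eval hf.irreducible hf.pairwise_not_associated
  set D : ℝ := ∑ i, ((f i).natDegree : ℝ) * (M i : ℝ) with hD
  set CpS : ℝ := ∑ i, ∑ j, max (Cp i j) 0 with hCpS
  set CpU : ℝ := ∑ i, ∑ j, max (Cu i j) 0 with hCpU
  set C₁ : ℝ := (k : ℝ) ^ 2 * (2 * (CpS + CpU) + 8 * (((P₀ : ℝ) + 1) ^ 4 + 4 * D ^ 2) + 4 * D) with hC₁
  set C₂ : ℝ := (k : ℝ) * (2 * D) with hC₂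
  have hD0 : 0 ≤ D := sum_nonneg fun i _ => by positivity
  have hCpS0 : 0 ≤ CpS := sum_nonneg fun i _ => sum_nonneg fun j _ => le_max_right _ _
  have hCpU0 : 0 ≤ CpU := sum_nonneg fun i _ => sum_nonneg fun j _ => le_max_right _ _
  have hC₁0 : 0 ≤ C₁ := by positivity
  have hC₂0 : 0 ≤ C₂ := by positivity
  have hCp_le : ∀ i j, Cp i j ≤ CpS := fun i j =>
    (le_max_left _ _).trans
      ((single_le_sum (f := fun j => max (Cp i j) 0) (fun j _ => le_max_right _ _) (mem_univ j)).trans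
        (single_le_sum (f := fun i => ∑ j, max (Cp i j) 0)
          (fun i _ => sum_nonneg fun j _ => le_max_right _ _) (mem_univ i)))
  have hCu_le : ∀ i j, Cu i j ≤ CpU := fun i j =>
    (le_max_left _ _).trans
      ((single_le_sum (f := fun j => max (Cu i j) 0) (fun j _ => le_max_right _ _) (mem_univ j)).trans
        (single_le_sum (f := fun i => ∑ j, max (Cu i j) 0)
          (fun i _ => sum_nonneg fun j _ => le_max_right _ _) (mem_univ i)))
  refine ⟨C₁ + 4 * C₂, fun x hx => ?_⟩
  /- ### parameters at `x` -/
  set z : ℕ := Nat.sqrt x with hz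
  have hz2 : 2 ≤ z := Nat.le_sqrt.2 (by omega)
  have hzx : z ≤ x := Nat.sqrt_le_self x
  have hzz : z * z ≤ x := Nat.sqrt_le x
  have hY0 : (0 : ℝ) < (x : ℝ) + 1 := by positivity
  have hzR : (2 : ℝ) ≤ (z : ℝ) := by exact_mod_cast hz2
  have hxR : (z : ℝ) ≤ (x : ℝ) := by exact_mod_cast hzx
  have hlogz0 : 0 ≤ Real.log z := Real.log_nonneg (by linarith)
  have hlogzx : Real.log z ≤ Real.log x := Real.log_le_log (by linarith) hxR
  have hlogx1 : (1 : ℝ) ≤ Real.log x := by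
    have h4 : (4 : ℝ) ≤ x := by exact_mod_cast hx
    have hlog4 : (1 : ℝ) ≤ Real.log 4 := by
      rw [Real.le_log_iff_exp_le (by norm_num)]
      have := Real.exp_one_lt_d9
      linarith
    exact hlog4.trans (Real.log_le_log (by norm_num) h4)
  have hlogx0 : (0 : ℝ) < Real.log x := by linarith
  /- ### the indicators `Zf (i, q)` -/
  set Zf : Fin k × ℕ → ℕ → ℝ := fun t n =>
    if t.2 ∣ ((f t.1).eval (n : ℤ)).toNat ∧ ((f t.1).eval (n : ℤ)).toNat ≠ 0 then 1 else 0 with hZf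
  have hZfdef : ∀ t n, Zf t n =
      if t.2 ∣ ((f t.1).eval (n : ℤ)).toNat ∧ ((f t.1).eval (n : ℤ)).toNat ≠ 0 then 1 else 0 :=
    fun t n => by rw [hZf]
  have hZsum : ∀ t, ∑ n ∈ range (x + 1), Zf t n =
      (#((range (x + 1)).filter fun n : ℕ =>
        t.2 ∣ ((f t.1).eval (n : ℤ)).toNat ∧ ((f t.1).eval (n : ℤ)).toNat ≠ 0) : ℝ) := fun t => by
    simp only [hZf]
    rw [sum_boole]
  have hZsum2 : ∀ t t', ∑ n ∈ range (x + 1), Zf t n * Zf t' n =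
      (#((range (x + 1)).filter fun n : ℕ =>
        (t.2 ∣ ((f t.1).eval (n : ℤ)).toNat ∧ ((f t.1).eval (n : ℤ)).toNat ≠ 0) ∧
          (t'.2 ∣ ((f t'.1).eval (n : ℤ)).toNat ∧ ((f t'.1).eval (n : ℤ)).toNat ≠ 0)) : ℝ) := by
    intro t t'
    simp only [hZf, ite_one_zero_mul_ite]
    rw [sum_boole]
  have hZcard : ∀ (i : Fin k) (S : Finset ℕ) (n : ℕ), ∑ q ∈ S, Zf (i, q) n =
      (#(S.filter (fun q => q ∣ ((f i).eval (n : ℤ)).toNat ∧ ((f i).eval (n : ℤ)).toNat ≠ 0)) : ℝ) := by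
    intro i S n
    simp only [hZf]
    rw [sum_boole]
  have hZcardΛ : ∀ (i : Fin k) (S : Finset ℕ) (n : ℕ), ∑ q ∈ S, ArithmeticFunction.vonMangoldt q * Zf (i, q) n =
      ∑ q ∈ S.filter (fun q => q ∣ ((f i).eval (n : ℤ)).toNat ∧ ((f i).eval (n : ℤ)).toNat ≠ 0), ArithmeticFunction.vonMangoldt q := by
    intro i S n
    rw [sum_filter]
    refine sum_congr rfl fun q _ => ?_
    simp only [hZf, mul_ite, mul_one, mul_zero]
  -- root-class bound for the means: `E 1_{i,q} ≤ 2D/q` for `q ∈ PP(x)`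
  have he : ∀ t : Fin k × ℕ, t.2 ∈ (Nat.primesLE x ∪ ((Nat.primesLE x).filter (fun p => p ^ 2 ≤ x)).image (fun p => p ^ 2)) →
      (∑ n ∈ range (x + 1), Zf t n) / ((x : ℝ) + 1) ≤ 2 * D / (t.2 : ℝ) := by
    rintro ⟨i, q⟩ hq
    obtain ⟨hpp, hq2, hqx⟩ := isPrimePow_and_le_of_mem_PP hq
    have hq0 : 0 < q := by omega
    have hqR : (0 : ℝ) < q := by exact_mod_cast hq0
    rw [hZsum]
    refine (card_filter_dvd_toNat_div_le (f i) hq0 x).trans ?_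
    obtain ⟨p, a, hp, ha, rfl⟩ := (isPrimePow_nat_iff q).1 hpp
    have hρD : (polyRootCountMod ![f i] (p ^ a) : ℝ) ≤ D := by
      have h1 : (polyRootCountMod ![f i] (p ^ a) : ℝ) ≤ ((f i).natDegree : ℝ) * (M i : ℝ) := by
        exact_mod_cast hM i p hp a
      exact h1.trans (single_le_sum (f := fun i => ((f i).natDegree : ℝ) * (M i : ℝ))
        (fun i _ => by positivity) (mem_univ i))
    have hY' : 1 / ((x : ℝ) + 1) ≤ 1 / ((p ^ a : ℕ) : ℝ) :=
      one_div_le_one_div_of_le hqR (by exact_mod_cast Nat.le_succ_of_le hqx)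
    calc (polyRootCountMod ![f i] (p ^ a) : ℝ) * (1 / ((p ^ a : ℕ) : ℝ) + 1 / ((x : ℝ) + 1))
        ≤ D * (1 / ((p ^ a : ℕ) : ℝ) + 1 / ((x : ℝ) + 1)) :=
          mul_le_mul_of_nonneg_right hρD (by positivity)
      _ ≤ D * (1 / ((p ^ a : ℕ) : ℝ) + 1 / ((p ^ a : ℕ) : ℝ)) :=
          mul_le_mul_of_nonneg_left (add_le_add_right hY' _) hD0
      _ = 2 * D / ((p ^ a : ℕ) : ℝ) := by ring
  have hpair : ∀ t t' : Fin k × ℕ, t.2 ∈ (Nat.primesLE x ∪ ((Nat.primesLE x).filter (fun p => p ^ 2 ≤ x)).image (fun p => p ^ 2)) → t'.2 ∈ (Nat.primesLE x ∪ ((Nat.primesLE x).filter (fun p => p ^ 2 ≤ x)).image (fun p => p ^ 2)) → Nat.Coprime t.2 t'.2 →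
      (∑ n ∈ range (x + 1), Zf t n) / ((x : ℝ) + 1) * ((∑ n ∈ range (x + 1), Zf t' n) / ((x : ℝ) + 1)) -
        (∑ n ∈ range (x + 1), Zf t n * Zf t' n) / ((x : ℝ) + 1) ≤ CpS / ((x : ℝ) + 1) := by
    rintro ⟨i, q⟩ ⟨j, q'⟩ hq hq' hcop
    rw [hZsum, hZsum, hZsum2]
    exact (hCp i j x q q' (isPrimePow_and_le_of_mem_PP hq).1 (isPrimePow_and_le_of_mem_PP hq').1
      hcop).trans (div_le_div_of_nonneg_right (hCp_le i j) hY0.le)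
  have hpairU : ∀ t t' : Fin k × ℕ, t.2 ∈ (Nat.primesLE x ∪ ((Nat.primesLE x).filter (fun p => p ^ 2 ≤ x)).image (fun p => p ^ 2)) → t'.2 ∈ (Nat.primesLE x ∪ ((Nat.primesLE x).filter (fun p => p ^ 2 ≤ x)).image (fun p => p ^ 2)) → Nat.Coprime t.2 t'.2 →
      (∑ n ∈ range (x + 1), Zf t n * Zf t' n) / ((x : ℝ) + 1) -
        (∑ n ∈ range (x + 1), Zf t n) / ((x : ℝ) + 1) * ((∑ n ∈ range (x + 1), Zf t' n) / ((x : ℝ) + 1)) ≤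
        CpU / ((x : ℝ) + 1) := by
    rintro ⟨i, q⟩ ⟨j, q'⟩ hq hq' hcop
    rw [hZsum, hZsum, hZsum2]
    exact (hCu i j x q q' (isPrimePow_and_le_of_mem_PP hq).1 (isPrimePow_and_le_of_mem_PP hq').1
      hcop).trans (div_le_div_of_nonneg_right (hCu_le i j) hY0.le)
  have hcross : ∀ i j : Fin k, i ≠ j → ∀ p : ℕ, P₀ < p → ∀ n : ℤ,
      ¬ ((p : ℤ) ∣ (f i).eval n ∧ (p : ℤ) ∣ (f j).eval n) := fun i j hij p hp n => hP₀ p hp i j hij n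
  /- ### the block -/
  have hblock := rblock_abs_le k f x z P₀ Zf D CpS CpU hD0 hCpS0 hCpU0 hzx hzz hZfdef he hpair hpairU
    hcross (stub_pairBookkeeping x).1 (stub_pairBookkeeping x).2
  /- ### the functions `a`, `r` -/
  obtain ⟨a, ha⟩ : ∃ a : ℕ → ℝ, a = fun n => ∑ t ∈ (univ : Finset (Fin k)) ×ˢ (Nat.primesLE z ∪ ((Nat.primesLE z).filter (fun p => p ^ 2 ≤ z)).image (fun p => p ^ 2)), Zf t n := ⟨_, rfl⟩
  obtain ⟨r, hr⟩ : ∃ r : ℕ → ℝ, r = fun n => ∑ t ∈ (univ : Finset (Fin k)) ×ˢ (Nat.primesLE z ∪ ((Nat.primesLE z).filter (fun p => p ^ 2 ≤ z)).image (fun p => p ^ 2)), ArithmeticFunction.vonMangoldt t.2 * Zf t n := ⟨_, rfl⟩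
  have haf : ∀ n : ℕ, ∑ t ∈ (univ : Finset (Fin k)) ×ˢ (Nat.primesLE z ∪ ((Nat.primesLE z).filter (fun p => p ^ 2 ≤ z)).image (fun p => p ^ 2)), Zf t n = a n := fun n => by rw [ha]
  have hrf : ∀ n : ℕ, ∑ t ∈ (univ : Finset (Fin k)) ×ˢ (Nat.primesLE z ∪ ((Nat.primesLE z).filter (fun p => p ^ 2 ≤ z)).image (fun p => p ^ 2)), ArithmeticFunction.vonMangoldt t.2 * Zf t n = r n := fun n => by rw [hr]
  have hA_eq : ∀ n : ℕ, ((∑ i, #((Nat.primesLE z ∪ ((Nat.primesLE z).filter (fun p => p ^ 2 ≤ z)).image (fun p => p ^ 2)).filter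
      (fun q => q ∣ ((f i).eval (n : ℤ)).toNat ∧ ((f i).eval (n : ℤ)).toNat ≠ 0)) : ℕ) : ℝ) = a n := fun n => by
    rw [ha, Nat.cast_sum]
    simp only
    rw [sum_product]
    exact (sum_congr rfl fun i _ => hZcard i _ n).symm
  have hR_eq : ∀ n : ℕ, (∑ i, ∑ q ∈ (Nat.primesLE z ∪ ((Nat.primesLE z).filter (fun p => p ^ 2 ≤ z)).image (fun p => p ^ 2)).filter (fun q => q ∣ ((f i).eval (n : ℤ)).toNat ∧ ((f i).eval (n : ℤ)).toNat ≠ 0), ArithmeticFunction.vonMangoldt q) = r n := fun n => by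
    rw [hr]
    simp only
    rw [sum_product]
    exact (sum_congr rfl fun i _ => hZcardΛ i _ n).symm
  simp only [haf, hrf] at hblock
  have h1 : (∑ n ∈ Finset.range (x + 1),
      ((∑ i, #((Nat.primesLE z ∪ ((Nat.primesLE z).filter (fun p => p ^ 2 ≤ z)).image (fun p => p ^ 2)).filter (fun q => q ∣ ((f i).eval (n : ℤ)).toNat ∧ ((f i).eval (n : ℤ)).toNat ≠ 0)) : ℕ) : ℝ) *
        ((∑ i, ∑ q ∈ (Nat.primesLE z ∪ ((Nat.primesLE z).filter (fun p => p ^ 2 ≤ z)).image (fun p => p ^ 2)).filter (fun q => q ∣ ((f i).eval (n : ℤ)).toNat ∧ ((f i).eval (n : ℤ)).toNat ≠ 0), ArithmeticFunction.vonMangoldt q) / Real.log x)) =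
      ∑ n ∈ range (x + 1), a n * (r n / Real.log x) :=
    sum_congr rfl fun n _ => by rw [hA_eq n, hR_eq n]
  have h2 : (∑ n ∈ Finset.range (x + 1),
      ((∑ i, #((Nat.primesLE z ∪ ((Nat.primesLE z).filter (fun p => p ^ 2 ≤ z)).image (fun p => p ^ 2)).filter (fun q => q ∣ ((f i).eval (n : ℤ)).toNat ∧ ((f i).eval (n : ℤ)).toNat ≠ 0)) : ℕ) : ℝ)) =
      ∑ n ∈ range (x + 1), a n := sum_congr rfl fun n _ => hA_eq n
  have h3 : (∑ n ∈ Finset.range (x + 1),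
      (∑ i, ∑ q ∈ (Nat.primesLE z ∪ ((Nat.primesLE z).filter (fun p => p ^ 2 ≤ z)).image (fun p => p ^ 2)).filter (fun q => q ∣ ((f i).eval (n : ℤ)).toNat ∧ ((f i).eval (n : ℤ)).toNat ≠ 0), ArithmeticFunction.vonMangoldt q) / Real.log x) =
      ∑ n ∈ range (x + 1), r n / Real.log x := sum_congr rfl fun n _ => by rw [hR_eq n]
  rw [h1, h2, h3, cov_div_const, abs_div, abs_of_pos hlogx0, div_le_iff₀ hlogx0]
  calc |(∑ n ∈ range (x + 1), a n * r n) / ((x : ℝ) + 1) -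
        (∑ n ∈ range (x + 1), a n) / ((x : ℝ) + 1) * ((∑ n ∈ range (x + 1), r n) / ((x : ℝ) + 1))|
      ≤ Real.log z * C₁ + C₂ * (2 * Real.log z + 2) := hblock
    _ ≤ Real.log x * C₁ + C₂ * (2 * Real.log x + 2 * Real.log x) := by
        have h4 : C₂ * (2 * Real.log z + 2) ≤ C₂ * (2 * Real.log x + 2 * Real.log x) :=
          mul_le_mul_of_nonneg_left (by linarith) hC₂0
        nlinarith [mul_le_mul_of_nonneg_right hlogzx hC₁0]
    _ = (C₁ + 4 * C₂) * Real.log x := by ring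

/-! ### Size terms: the covariance of the small count with `Σᵢ log fᵢ(n)⁺ / log x` is `O(1)` -/

/-- `Σ_{0 ≤ n ≤ x} (log x − log n) ≤ 2x` (with `log 0 = 0`). [folklore] -/
theorem sum_log_sub_log_le (x : ℕ) :
    ∑ n ∈ range (x + 1), (Real.log x - Real.log n) ≤ 2 * x := by
  induction x with
  | zero => simp
  | succ m ih =>
    rw [sum_range_succ, sub_self, add_zero]
    have hsplit : ∑ n ∈ range (m + 1), (Real.log ((m + 1 : ℕ) : ℝ) - Real.log n) =
        ∑ n ∈ range (m + 1), (Real.log (m : ℝ) - Real.log n) +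
          ((m + 1 : ℕ) : ℝ) * (Real.log ((m + 1 : ℕ) : ℝ) - Real.log m) := by
      rw [sum_congr rfl fun (n : ℕ) _ => show Real.log ((m + 1 : ℕ) : ℝ) - Real.log (n : ℝ) =
          (Real.log (m : ℝ) - Real.log (n : ℝ)) + (Real.log ((m + 1 : ℕ) : ℝ) - Real.log (m : ℝ)) by ring,
        sum_add_distrib, sum_const, card_range, nsmul_eq_mul]
    have hstep : ((m + 1 : ℕ) : ℝ) * (Real.log ((m + 1 : ℕ) : ℝ) - Real.log m) ≤ 2 := by
      rcases Nat.eq_zero_or_pos m with rfl | hm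
      · simp
      · have hmR : (0 : ℝ) < m := by exact_mod_cast hm
        have hm1 : (1 : ℝ) ≤ m := by exact_mod_cast hm
        have h1 : Real.log ((m + 1 : ℕ) : ℝ) - Real.log m ≤ 1 / m := by
          rw [← Real.log_div (by positivity) hmR.ne']
          have h2 := Real.log_le_sub_one_of_pos (show (0 : ℝ) < ((m + 1 : ℕ) : ℝ) / m by positivity)
          have h3 : ((m + 1 : ℕ) : ℝ) / m - 1 = 1 / m := by
            field_simp
            push_cast
            ring
          linarith
        calc ((m + 1 : ℕ) : ℝ) * (Real.log ((m + 1 : ℕ) : ℝ) - Real.log m)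
            ≤ ((m + 1 : ℕ) : ℝ) * (1 / m) := mul_le_mul_of_nonneg_left h1 (by positivity)
          _ ≤ 2 := by
              rw [mul_one_div, div_le_iff₀ hmR]
              push_cast
              linarith
    rw [hsplit]
    push_cast at ih hstep ⊢
    linarith

/-- Two-sided polynomial growth: for `g ∈ ℤ[X]` of positive degree `d` and positive leading
coefficient, `n^d ≤ 2·g(n)` for all large `n ∈ ℕ`. [folklore] -/
theorem exists_forall_pow_le_two_mul_eval (g : ℤ[X]) (hdeg : 0 < g.natDegree) (hlc : 0 < g.leadingCoeff) :
    ∃ n₀ : ℕ, ∀ n : ℕ, n₀ ≤ n → (n : ℝ) ^ g.natDegree ≤ 2 * ((g.eval (n : ℤ) : ℤ) : ℝ) := by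
  set P : ℝ[X] := g.map (Int.castRingHom ℝ) with hP
  have hPdeg : P.natDegree = g.natDegree := natDegree_map_eq_of_injective Int.cast_injective _
  have hPlc : P.leadingCoeff = (g.leadingCoeff : ℝ) := by
    rw [hP, leadingCoeff_map_of_injective Int.cast_injective, eq_intCast]
  have hlc1 : (1 : ℝ) ≤ (g.leadingCoeff : ℝ) := by exact_mod_cast hlc
  have hev := (Polynomial.isEquivalent_atTop_lead (P := P)).isLittleO.def (by norm_num : (0 : ℝ) < 1 / 2)
  obtain ⟨n₀, hn₀⟩ := Filter.eventually_atTop.1 (tendsto_natCast_atTop_atTop.eventually hev)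
  refine ⟨n₀, fun n hn => ?_⟩
  have h := hn₀ n hn
  simp only [Pi.sub_apply, Real.norm_eq_abs] at h
  rw [hPdeg, hPlc] at h
  have heval : eval (n : ℝ) P = ((g.eval (n : ℤ) : ℤ) : ℝ) := by
    rw [hP, eval_natCast_map, eq_intCast]
  rw [heval] at h
  have hnd : (0 : ℝ) ≤ (n : ℝ) ^ g.natDegree := by positivity
  have hv0 : 0 ≤ (g.leadingCoeff : ℝ) * (n : ℝ) ^ g.natDegree := by positivity
  rw [abs_of_nonneg hv0] at h
  have h' := (abs_le.1 h).1
  have _hd := hdeg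
  nlinarith

/-- The small count along the values is `O(log x)` pointwise: for `0 ≤ n ≤ x`, `1 ≤ x`,
`#{q ∈ PP(z) : q ∣ g(n)⁺ ≠ 0} ≤ (2/log 2)(log(H+1) + d(log x + 1))`, `H = Σ|coeff|`, `d = deg g`
(`≤ 2 log₂ g(n)⁺` prime(-square) factors, `g(n)⁺ ≤ H(x+1)^d`). [folklore] -/
theorem smallCount_le_log (g : ℤ[X]) (z : ℕ) {n x : ℕ} (hx : 1 ≤ x) (hn : n ≤ x) :
    (#((Nat.primesLE z ∪ ((Nat.primesLE z).filter (fun p => p ^ 2 ≤ z)).image (fun p => p ^ 2)).filter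
        (fun q => q ∣ (g.eval (n : ℤ)).toNat ∧ (g.eval (n : ℤ)).toNat ≠ 0)) : ℝ) ≤
      2 / Real.log 2 * (Real.log ((∑ j ∈ range (g.natDegree + 1), (g.coeff j).natAbs : ℕ) + 1) +
        g.natDegree * (Real.log x + 1)) := by
  set m : ℕ := (g.eval (n : ℤ)).toNat with hm
  set H : ℕ := ∑ j ∈ range (g.natDegree + 1), (g.coeff j).natAbs with hH
  have hlog2 : (0 : ℝ) < Real.log 2 := Real.log_pos one_lt_two
  have hxR : (1 : ℝ) ≤ x := by exact_mod_cast hx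
  have hlogx0 : 0 ≤ Real.log x := Real.log_nonneg hxR
  have hH0 : (0 : ℝ) ≤ Real.log ((H : ℝ) + 1) := Real.log_nonneg (by have := Nat.cast_nonneg (α := ℝ) H; linarith)
  have hcard : (#((Nat.primesLE z ∪ ((Nat.primesLE z).filter (fun p => p ^ 2 ≤ z)).image (fun p => p ^ 2)).filter
      (fun q => q ∣ m ∧ m ≠ 0)) : ℝ) ≤ 2 * (Nat.log 2 m : ℝ) := by
    exact_mod_cast card_PP_filter_le_two_mul_log z m
  have hlogm : (Nat.log 2 m : ℝ) ≤ Real.log m / Real.log 2 := by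
    have := Real.natLog_le_logb m 2
    rwa [Real.logb] at this
  have hmle : m ≤ H * (x + 1) ^ g.natDegree := toNat_eval_le g hn
  have hlogm' : Real.log m ≤ Real.log ((H : ℝ) + 1) + g.natDegree * (Real.log x + 1) := by
    rcases Nat.eq_zero_or_pos m with h0 | hmpos
    · rw [h0, Nat.cast_zero, Real.log_zero]
      positivity
    · have h1 : (m : ℝ) ≤ ((H : ℝ) + 1) * ((x : ℝ) + 1) ^ g.natDegree := by
        have h2 : (m : ℝ) ≤ (H : ℝ) * ((x : ℝ) + 1) ^ g.natDegree := by exact_mod_cast hmle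
        have h3 : (H : ℝ) * ((x : ℝ) + 1) ^ g.natDegree ≤ ((H : ℝ) + 1) * ((x : ℝ) + 1) ^ g.natDegree :=
          mul_le_mul_of_nonneg_right (by linarith) (by positivity)
        exact h2.trans h3
      have hx1 : Real.log ((x : ℝ) + 1) ≤ Real.log x + 1 := by
        have h4 : Real.log ((x : ℝ) + 1) - Real.log x ≤ 1 := by
          rw [← Real.log_div (by positivity) (by positivity)]
          have h5 := Real.log_le_sub_one_of_pos (show (0 : ℝ) < ((x : ℝ) + 1) / x by positivity)
          have h6 : ((x : ℝ) + 1) / x - 1 = 1 / x := by field_simp; ring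
          have h7 : (1 : ℝ) / x ≤ 1 := by rw [div_le_one (by positivity)]; exact hxR
          linarith
        linarith
      calc Real.log m ≤ Real.log (((H : ℝ) + 1) * ((x : ℝ) + 1) ^ g.natDegree) :=
            Real.log_le_log (by exact_mod_cast hmpos) h1
        _ = Real.log ((H : ℝ) + 1) + g.natDegree * Real.log ((x : ℝ) + 1) := by
            rw [Real.log_mul (by positivity) (by positivity), Real.log_pow]
        _ ≤ Real.log ((H : ℝ) + 1) + g.natDegree * (Real.log x + 1) := by gcongr
  calc (#((Nat.primesLE z ∪ ((Nat.primesLE z).filter (fun p => p ^ 2 ≤ z)).image (fun p => p ^ 2)).filter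
        (fun q => q ∣ m ∧ m ≠ 0)) : ℝ)
      ≤ 2 * (Nat.log 2 m : ℝ) := hcard
    _ ≤ 2 * (Real.log m / Real.log 2) := by linarith
    _ = 2 / Real.log 2 * Real.log m := by ring
    _ ≤ 2 / Real.log 2 * (Real.log ((H : ℝ) + 1) + g.natDegree * (Real.log x + 1)) :=
        mul_le_mul_of_nonneg_left hlogm' (by positivity)

/-- A bounded nonnegative weight against an arbitrary function: `|Cov(a, g)| ≤ 2M · E|g − c|` for
`0 ≤ a ≤ M` on `0 ≤ n ≤ x` and any constant `c` (`Cov(a, g) = Cov(a, g − c)`). [folklore] -/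
theorem abs_cov_le_two_mul_sup_mul_mean_abs (x : ℕ) (a g : ℕ → ℝ) (M c : ℝ)
    (ha0 : ∀ n ∈ range (x + 1), 0 ≤ a n) (haM : ∀ n ∈ range (x + 1), a n ≤ M) :
    |(∑ n ∈ range (x + 1), a n * g n) / ((x : ℝ) + 1) -
        (∑ n ∈ range (x + 1), a n) / ((x : ℝ) + 1) * ((∑ n ∈ range (x + 1), g n) / ((x : ℝ) + 1))| ≤
      2 * M * ((∑ n ∈ range (x + 1), |g n - c|) / ((x : ℝ) + 1)) := by
  have hY : (0 : ℝ) < (x : ℝ) + 1 := by positivity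
  have hM0 : 0 ≤ M := (ha0 0 (mem_range.2 (Nat.succ_pos x))).trans (haM 0 (mem_range.2 (Nat.succ_pos x)))
  have key : (∑ n ∈ range (x + 1), a n * g n) / ((x : ℝ) + 1) -
      (∑ n ∈ range (x + 1), a n) / ((x : ℝ) + 1) * ((∑ n ∈ range (x + 1), g n) / ((x : ℝ) + 1)) =
      (∑ n ∈ range (x + 1), a n * (g n - c)) / ((x : ℝ) + 1) -
        (∑ n ∈ range (x + 1), a n) / ((x : ℝ) + 1) * ((∑ n ∈ range (x + 1), (g n - c)) / ((x : ℝ) + 1)) := by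
    have h1 : ∑ n ∈ range (x + 1), a n * (g n - c) =
        ∑ n ∈ range (x + 1), a n * g n - c * ∑ n ∈ range (x + 1), a n := by
      rw [mul_sum, ← sum_sub_distrib]
      exact sum_congr rfl fun n _ => by ring
    rw [h1, sum_sub_distrib, sum_const, card_range, nsmul_eq_mul]
    field_simp
    push_cast
    ring
  rw [key]
  have hS0 : 0 ≤ ∑ n ∈ range (x + 1), |g n - c| := sum_nonneg fun n _ => abs_nonneg _
  have h1 : |∑ n ∈ range (x + 1), a n * (g n - c)| ≤ M * ∑ n ∈ range (x + 1), |g n - c| := by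
    refine (abs_sum_le_sum_abs _ _).trans ?_
    rw [mul_sum]
    refine sum_le_sum fun n hn => ?_
    rw [abs_mul, abs_of_nonneg (ha0 n hn)]
    exact mul_le_mul_of_nonneg_right (haM n hn) (abs_nonneg _)
  have h2 : |∑ n ∈ range (x + 1), a n| ≤ M * ((x : ℝ) + 1) := by
    rw [abs_of_nonneg (sum_nonneg ha0)]
    calc ∑ n ∈ range (x + 1), a n ≤ ∑ _n ∈ range (x + 1), M := sum_le_sum haM
      _ = M * ((x : ℝ) + 1) := by rw [sum_const, card_range, nsmul_eq_mul]; push_cast; ring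
  have h3 : |∑ n ∈ range (x + 1), (g n - c)| ≤ ∑ n ∈ range (x + 1), |g n - c| := abs_sum_le_sum_abs _ _
  have hA : |(∑ n ∈ range (x + 1), a n * (g n - c)) / ((x : ℝ) + 1)| ≤
      M * ((∑ n ∈ range (x + 1), |g n - c|) / ((x : ℝ) + 1)) := by
    rw [abs_div, abs_of_pos hY, div_le_iff₀ hY]
    calc _ ≤ M * ∑ n ∈ range (x + 1), |g n - c| := h1
      _ = M * ((∑ n ∈ range (x + 1), |g n - c|) / ((x : ℝ) + 1)) * ((x : ℝ) + 1) := by field_simp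
  have hB : |(∑ n ∈ range (x + 1), a n) / ((x : ℝ) + 1) * ((∑ n ∈ range (x + 1), (g n - c)) / ((x : ℝ) + 1))| ≤
      M * ((∑ n ∈ range (x + 1), |g n - c|) / ((x : ℝ) + 1)) := by
    rw [abs_mul, abs_div, abs_div, abs_of_pos hY]
    have h4 : |∑ n ∈ range (x + 1), a n| / ((x : ℝ) + 1) ≤ M := by
      rw [div_le_iff₀ hY]; exact h2
    have h5 : |∑ n ∈ range (x + 1), (g n - c)| / ((x : ℝ) + 1) ≤ (∑ n ∈ range (x + 1), |g n - c|) / ((x : ℝ) + 1) :=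
      div_le_div_of_nonneg_right h3 hY.le
    exact mul_le_mul h4 h5 (by positivity) hM0
  calc _ ≤ |(∑ n ∈ range (x + 1), a n * (g n - c)) / ((x : ℝ) + 1)| +
        |(∑ n ∈ range (x + 1), a n) / ((x : ℝ) + 1) * ((∑ n ∈ range (x + 1), (g n - c)) / ((x : ℝ) + 1))| :=
        abs_sub _ _
    _ ≤ M * ((∑ n ∈ range (x + 1), |g n - c|) / ((x : ℝ) + 1)) + M * ((∑ n ∈ range (x + 1), |g n - c|) / ((x : ℝ) + 1)) :=
        add_le_add hA hB
    _ = 2 * M * ((∑ n ∈ range (x + 1), |g n - c|) / ((x : ℝ) + 1)) := by ring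

end Summit.Parity.BatemanHorn.Cruxes.SystemMomentDeficit.MassCount
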